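import Summits.QuantumFields.BalabanUV.Beta.EriceRemainderEnclosureHistoryAutonomyComparisonAgeCompositionDecayBoundaryFlow

/-!
# EriceRemainderEnclosureHistoryAutonomyComparisonAgeCompositionDecayEnd — (E85f) route (N), first order: THE DAMPED TWO-AGE END WITH NO STATIC HYPOTHESIS —
# the static decay family (S-d) holds along EVERY box flow of an isotone memory with floor dominated by a two-age profile, for EVERY damping of the relaxed
# class, so the comparison surplus of every admissible excess is non-negative unconditionally

Cell `pub-balaban`, β-function sub-cell, BINDER row D4 «RemainderConst leaves for Bałaban's split» (`HOME/BINDER-OWNERS.md`; owner lineage `b2b-balaban-beta-an4`;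
this file by co-owner #2 lineage `b2b-balaban-beta-d4-p2`, generation 76), β-FLOW TEAM duty (1), FREEZE (0) honoured (def-free; imports (E85e)
`…DecayBoundaryFlow`; uses (E84b) `flow_nonneg_two_ages_of_linear_budget`, (E84c) `budget_of_slots`, (E85d) `slot_deep`, (E85e) `slot_first_merged` BY NAME;
nothing restated).  Closes successor item (1) of README `HOME/b2b-balaban-beta-d4-p2/g74/e83/README.md` §4 and (E84d-2) of README `g75/e84`: the one static
family (S-d) of (E83k) `flow_nonneg_two_ages_decay` is DISCHARGED along flows.

HONEST FRAMING (page 1, verbatim and binding).  *"Discharging BetaPertH makes Bałaban's UV stability UNCONDITIONAL — a real constructive-QFT result; it is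
NOT the continuum limit and NOT the Clay problem."*  THIS FILE DISCHARGES NOTHING OF THE KIND.  Elementary real analysis about ABSTRACT functionals on a box
]0,γ]^ℕ with displayed floors, profiles and signs, and the FIRST-ORDER renewal objects of route (N) built from them — hypotheses of a census, not facts; the
form, signs, ages and moments of Bałaban's (1.22) limit functional are NOT PRINTED ([I] p. 298; GAPS G-t4-U2-1∕-2) and NOT asserted.  Row D4 class
UNCHANGED (critical-path width 0; instance 0∕1; D4 DISCHARGE NO DATE).  HONEST DEPENDENCY: continuum YM on T⁴ ⇐ BetaPertH ∧ nine spine estimates (0/9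
proved); BetaPertH ⇐ (D1) ∧ (D4) ∧ CAP+tail; G-an2-4 gates asym, D1 and NE2/3/4.

THE POINT (census sense (α); route (N); README `HOME/b2b-balaban-beta-d4-p2/g76/e85/README.md`).  §1 `budget_along_flow`: at every pin `m` the linearised budget
of (E84b) holds along the flow — (E84c) `budget_of_slots` with the ALLOCATION `S_p = (4∕3)d_{p+1}` for the deep slots `p ≥ m+3` ((E85d) `slot_deep`) and
`S_{m+2} = F_{m+2} + DE − A_{m+k} − Σ_{q≥m+3} S_q` for the first slot, whose slot inequality is (E85e) `slot_first_merged` and whose boundary inequality is then an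
identity.  §2 **`flow_nonneg_two_ages`**: ROUTE (N), FIRST ORDER, END FOR TWO-AGE FLOWS, EVERY DAMPING OF THE RELAXED CLASS, NO STATIC HYPOTHESIS — as (E84b)
`flow_nonneg_two_ages_of_linear_budget` with `hdH` and `hbudget` discharged: for the two-age profile `{1, k}` (`2 ≤ k`, `K = k+1`), `h` a box solution of an
isotone memory `B` with floor `b > 0` dominated by `L ≥ 0`, ANY damping `g` with `1∕(1+F_t) ≤ g_t ≤ 1`, and the first-order objects of route (N) as displayed,
the comparison surplus `ε` of every admissible excess `e` is non-negative.  NUMERICS OF RECORD: `g75/numerics` (the exact (S-d) never violated, margin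
`≥ 0.15·S`), `g76/numerics` (the chains of this allocation: `SY ≥ 0.12`, `SO ≥ 0.28`, `MO ≥ 0.26`, `MY ≥ 0.33`).  NOT CLAIMED: three or more loaded ages; a
general horizon `K > k+1`; dampings outside the relaxed class; anything nonlinear; anything printed — in particular NOT B12 Thm 2, NOT BetaPertH.

WHAT IS PROVED ([folklore]; 0 `def`, 0 sorry).  §1 `budget_along_flow`; §2 **`flow_nonneg_two_ages`**.
-/
noncomputable section
open Finset

namespace Summit.QuantumFields.BalabanUV.Beta.EriceRemainderEnclosureHistoryAutonomyComparisonAgeCompositionDecayEnd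

open Literature.MathematicalPhysics.QuantumFieldTheory.Balaban1983to89
open Literature.MathematicalPhysics.QuantumFieldTheory.Balaban1983to89.T4BetaStationary
open Literature.MathematicalPhysics.QuantumFieldTheory.Balaban1983to89.T4BetaFlowWellPosed
open Summit.QuantumFields.BalabanUV.Beta.EriceRemainderEnclosureHistoryAutonomyComparisonAgeCompositionDecayBudget (flow_nonneg_two_ages_of_linear_budget)
open Summit.QuantumFields.BalabanUV.Beta.EriceRemainderEnclosureHistoryAutonomyComparisonAgeCompositionDecayBudgetSlots (budget_of_slots)
open Summit.QuantumFields.BalabanUV.Beta.EriceRemainderEnclosureHistoryAutonomyComparisonAgeCompositionDecaySlotFlow (slot_deep)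
open Summit.QuantumFields.BalabanUV.Beta.EriceRemainderEnclosureHistoryAutonomyComparisonAgeCompositionDecayBoundaryFlow (slot_first_merged)

variable {B : (ℕ → ℝ) → ℝ} {γ b gIR : ℝ} {L : ℕ → ℝ} {K : ℕ} {h g : ℕ → ℝ} {KL θ : ℕ → ℕ → ℕ → ℝ}

/-! ## §1 The linearised budget along the flow -/

/-- **THE LINEARISED (S-d) BUDGET HOLDS ALONG EVERY TWO-AGE FLOW.**  Two-age profile `{1, k}` (`2 ≤ k`, `K = k+1`), `h` a box solution of an isotone memory
with floor dominated by `L ≥ 0`; `c`, `d`, `F`, `Hup` as in (E84a)∕(E84b).  At every pin `m`: `d_{m+2}Hup_{m+2} < 1` and the budget of (E84b)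
`flow_nonneg_two_ages_of_linear_budget` — (E84c) `budget_of_slots` with `S_p = (4∕3)d_{p+1}` for `p ≥ m+3` ((E85d) `slot_deep`) and the first slot taking the
boundary ((E85e) `slot_first_merged`). [folklore] -/
theorem budget_along_flow (hmono : ∀ u v : ℕ → ℝ, SeqBox γ u → SeqBox γ v → (∀ j, u j ≤ v j) → B u ≤ B v)
    (hL : ∀ k, 0 ≤ L k) (hb : 0 < b) (hlo : ∀ u, SeqBox γ u → b ≤ B u) (hdom : ∀ u, SeqBox γ u → ∑ k ∈ range K, L k * u k ≤ B u)
    (hh : SeqBox γ h) (hf : MemFlow B gIR h) {k : ℕ} (hk2 : 2 ≤ k) (hKk : K = k + 1) (hL2 : ∀ j, j < K → j ≠ 1 → j ≠ k → L j = 0)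
    {c d F Hup : ℕ → ℝ} (hc : ∀ n, c n = L k * h (n + k) ^ 3 / 2) (hd : ∀ n, d n = L 1 * h (n + 1) ^ 3 / 2)
    (hF : ∀ t, F t = ∑ j ∈ range K, L j * h (t + j) ^ 3 / 2)
    (hHup : ∀ p, Hup p = (1 + (1 - (h (p + k + 1) / h (p + k)) ^ 3 / (1 + F (p + k + 1))) * ((k * c p) / (1 - k * c p))) / (1 - c p))
    (m : ℕ) :
    d (m + 2) * Hup (m + 2) < 1 ∧
    ∑ t ∈ Ico (m + 1) (m + k + 1), F t + F (m + 2)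
        + ∑ p ∈ Ico (m + 2) (m + 2 + k), ((1 - (h (p + k + 1) / h (p + k)) ^ 3 / (1 + F (p + k + 1))) * ((k * c p) / (1 - k * c p)) + c p / (1 - c p))
        + d (m + 2) * Hup (m + 2) / (1 - d (m + 2) * Hup (m + 2)) ≤
      3 / 2 * ((1 - (h (m + k + 1) / h (m + k)) ^ 2) + (1 - (h (m + k + 1) / h (m + k)) ^ 2) ^ 2 / 2)
        + ∑ p ∈ Ico (m + 2) (m + 2 + k), 3 / 2 * ((1 - (h (p + 1) / h p) ^ 2) + (1 - (h (p + 1) / h p) ^ 2) ^ 2 / 2) := by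
  have hmerged := slot_first_merged hmono hL hb hlo hdom hh hf hk2 hKk hL2 hc hd hF hHup m
  refine ⟨hmerged.1, ?_⟩
  -- the allocation
  have H := budget_of_slots (m := m) (k := k) (F := F) (G := fun p => c p / (1 - c p))
    (V := fun p => (1 - (h (p + k + 1) / h (p + k)) ^ 3 / (1 + F (p + k + 1))) * ((k * c p) / (1 - k * c p)))
    (A := fun p => 3 / 2 * ((1 - (h (p + 1) / h p) ^ 2) + (1 - (h (p + 1) / h p) ^ 2) ^ 2 / 2))
    (S := fun p => if p = m + 2 then F (m + 2) + d (m + 2) * Hup (m + 2) / (1 - d (m + 2) * Hup (m + 2))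
        - 3 / 2 * ((1 - (h (m + k + 1) / h (m + k)) ^ 2) + (1 - (h (m + k + 1) / h (m + k)) ^ 2) ^ 2 / 2)
        - ∑ q ∈ Ico (m + 3) (m + 2 + k), 4 / 3 * d (q + 1) else 4 / 3 * d (p + 1))
    (Ab := 3 / 2 * ((1 - (h (m + k + 1) / h (m + k)) ^ 2) + (1 - (h (m + k + 1) / h (m + k)) ^ 2) ^ 2 / 2))
    (DE := d (m + 2) * Hup (m + 2) / (1 - d (m + 2) * Hup (m + 2))) ?_ ?_
  · simpa only using H
  · -- the slots
    intro p hp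
    rw [mem_Ico] at hp
    by_cases hpm : p = m + 2
    · subst hpm
      simp only [if_true, show m + 2 - 1 = m + 1 from rfl]
      have := hmerged.2
      linarith
    · simp only [if_neg hpm]
      obtain ⟨n, rfl⟩ : ∃ n, p = n + 1 := ⟨p - 1, by omega⟩
      have hn : 2 ≤ n := by omega
      have hs := slot_deep hmono hL hb hlo hdom hh hf hk2 hKk hL2 hn
      simp only [Nat.add_sub_cancel, hF, hc, hd]
      simpa only [hF] using hs
  · -- the boundary is an identity
    rw [sum_eq_sum_Ico_succ_bot (by omega : m + 2 < m + 2 + k)]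
    simp only [if_true, show m + 2 + 1 = m + 3 from rfl]
    rw [sum_congr rfl fun q hq => if_neg (by rw [mem_Ico] at hq; omega)]
    linarith

/-! ## §2 The END for two-age flows, no static hypothesis -/

/-- **ROUTE (N), FIRST ORDER, END FOR TWO-AGE FLOWS — EVERY DAMPING OF THE RELAXED CLASS, NO STATIC HYPOTHESIS.**  Two-age profile `{1, k}` (`2 ≤ k`, horizon
`K = k + 1`, `L_j = 0` for `j ∉ {1,k}`); `B` isotone with floor `b > 0` dominated by `L ≥ 0`; `h` a box solution (`MemFlow B gIR h`); `g` ANY damping with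
`1∕(1+F_t) ≤ g_t ≤ 1` (`F_t = Σ_jL_jh_{t+j}³∕2`); the lone kernels `KL`, defects `θ`, chain `ρ`, `β`, growth factors `Hg`, the solvers `SL`, `SA` and the
aggregated kernels `KA` of route (N) displayed as in (E81k)∕(E83k); `M`, `HgS` the bookkeeping letters of (E83k).  CONCLUSION: for every admissible excess `e`
(non-negative, non-increasing, eventually zero) the comparison surplus `ε` (`ε = e − RA 1 ε`, eventually zero) is non-negative at every pin.  PROOF: (E84b)
`flow_nonneg_two_ages_of_linear_budget` with its two remaining hypotheses — `d_{m+2}Hup_{m+2} < 1` and the linearised budget at every pin — supplied by §1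
`budget_along_flow`.  This discharges the static decay family (S-d) of (E83k) along flows; it is a statement about the census's abstract first-order objects
only. [folklore] -/
theorem flow_nonneg_two_ages (hmono : ∀ u v : ℕ → ℝ, SeqBox γ u → SeqBox γ v → (∀ j, u j ≤ v j) → B u ≤ B v)
    (hL : ∀ k, 0 ≤ L k) (hb : 0 < b) (hlo : ∀ u, SeqBox γ u → b ≤ B u) (hdom : ∀ u, SeqBox γ u → ∑ k ∈ range K, L k * u k ≤ B u)
    (hh : SeqBox γ h) (hf : MemFlow B gIR h)
    (hg : ∀ t, 0 < g t ∧ g t ≤ 1) (hgF : ∀ t, 1 / (1 + ∑ k ∈ range K, L k * h (t + k) ^ 3 / 2) ≤ g t)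
    {k : ℕ} (hk2 : 2 ≤ k) (hKk : K = k + 1) (hL2 : ∀ j, j < K → j ≠ 1 → j ≠ k → L j = 0)
    (hKL : ∀ k n l, KL k n l = if 0 < k ∧ k < K ∧ l < k then L k * h (n + k) ^ 3 / 2 * ∏ t ∈ Ico (n + 1 + l) (n + k + 1), g t else 0)
    (hθ : ∀ k n l, θ k n l = 1 - (h (n + k + l) / h (n + k)) ^ 3 * ∏ t ∈ Ico (n + k + 1) (n + k + l + 1), g t)
    {KA : ℕ → ℕ → ℕ → ℝ} {RL RA SL SA : ℕ → (ℕ → ℝ) → ℕ → ℝ}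
    (hRL : ∀ i v m, RL i v m = ∑ l ∈ range K, KL i m l * v (m + 1 + l))
    (hRA : ∀ i v m, RA i v m = ∑ l ∈ range K, KA i m l * v (m + 1 + l))
    (hKA : ∀ i m l, KA i m l = KL i m l + KA (i + 1) m l) (hKAtop : ∀ m l, KA K m l = 0)
    (hSL : ∀ i (w : ℕ → ℝ), (∀ m, K < m → w m = 0) → (∀ m, K < m → SL i w m = 0) ∧ ∀ m, SL i w m = w m - RL i (SL i w) m)
    (hSA : ∀ i (w : ℕ → ℝ), (∀ m, K < m → w m = 0) → (∀ m, K < m → SA i w m = 0) ∧ ∀ m, SA i w m = w m - RA i (SA i w) m)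
    {ρ : ℕ → ℕ → ℝ} {β : ℕ → ℕ → ℕ → ℝ}
    (hρ : ∀ i n, 1 ≤ i → i ≤ K - 1 → ρ i n = (∑ l ∈ range K, KL i n l) * (1 + ∑ k ∈ Ioc i (K - 1), θ k n i * β (i + 1) n k) /
      (1 - ∑ k ∈ Ioc i (K - 1), ∑ l ∈ range i, KL k n l))
    (hβnew : ∀ i n, 1 ≤ i → i ≤ K - 1 → β i n i = ρ i n / (1 - ρ i n))
    (hβold : ∀ i n k, 1 ≤ i → i < k → k ≤ K - 1 → β i n k = β (i + 1) n k / (1 - ρ i n))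
    {Hg : ℕ → ℕ → ℝ} (hH : ∀ i m, Hg i m = (1 + ∑ k ∈ Ioc i (K - 1), θ k m 1 * β (i + 1) m k) / (1 - ∑ k ∈ Ioc i (K - 1), KL k m 0))
    {M : ℕ → ℕ → ℝ} (hM : ∀ i m, M i m = KL i m 0 + ∑ l ∈ range (K - 1), max (KL i m (l + 1) - KL i (m + 1) l) 0)
    {HgS : ℕ → ℕ → ℕ → ℝ} (hHS : ∀ i j m, HgS i j m = (1 + ∑ k ∈ Ioc i (K - 1), θ k m 1 * β (i + 1) m k) /
      (1 - ∑ k ∈ Ioc i (K - 1), (KL k m 0 - if m + 1 + k ≤ j then KL k (m + 1) (k - 1) else 0)))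
    {e ε : ℕ → ℝ} (he0 : ∀ m, 0 ≤ e m) (hea : ∀ m, e (m + 1) ≤ e m) (het : ∀ m, K < m → e m = 0)
    (hεt : ∀ m, K < m → ε m = 0) (hεrec : ∀ m, ε m = e m - RA 1 ε m) : ∀ m, 0 ≤ ε m := by
  -- the displayed coefficient letters
  have hB := fun m => budget_along_flow hmono hL hb hlo hdom hh hf hk2 hKk hL2 (c := fun n => L k * h (n + k) ^ 3 / 2)
    (d := fun n => L 1 * h (n + 1) ^ 3 / 2) (F := fun t => ∑ j ∈ range K, L j * h (t + j) ^ 3 / 2)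
    (Hup := fun p => (1 + (1 - (h (p + k + 1) / h (p + k)) ^ 3 / (1 + ∑ j ∈ range K, L j * h (p + k + 1 + j) ^ 3 / 2))
      * ((k * (L k * h (p + k) ^ 3 / 2)) / (1 - k * (L k * h (p + k) ^ 3 / 2)))) / (1 - L k * h (p + k) ^ 3 / 2))
    (fun _ => rfl) (fun _ => rfl) (fun _ => rfl) (fun _ => rfl) m
  exact flow_nonneg_two_ages_of_linear_budget hmono hL hb hlo hdom hh hf hg hgF hk2 hKk hL2 hKL hθ hRL hRA hKA hKAtop hSL hSA hρ hβnew hβold hH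
    (c := fun n => L k * h (n + k) ^ 3 / 2) (d := fun n => L 1 * h (n + 1) ^ 3 / 2) (F := fun t => ∑ j ∈ range K, L j * h (t + j) ^ 3 / 2)
    (fun _ => rfl) (fun _ => rfl) (fun _ => rfl) (fun _ => rfl) (fun m => (hB m).1) (fun m => (hB m).2) hM hHS he0 hea het hεt hεrec

end Summit.QuantumFields.BalabanUV.Beta.EriceRemainderEnclosureHistoryAutonomyComparisonAgeCompositionDecayEnd

end
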